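import Mathlib
import Summits.Ventures.PercRepro2.PMK5Deg3Kernel
import Summits.Ventures.PercRepro2.PMK5Deg4Kernel
import Summits.Ventures.PercRepro2.PMK5Deg4Kernel5
import Summits.Ventures.PercRepro2.PMK5Deg4LitsOA1A2B0

/-!
# The table literals of the quadruple `(0, 1, 2, 4)`, five sliced edges, and their kernel certification, part 3 of 0–4
(blind cell PercRepro2, mine-2 g28; the degree-4 rung, `PMK5Deg4Kernel5.lean`)

`Loa1a2b i a b c d e` is the `512`-bit vector of the `i`-th of the nineteen tables of `K₅ + {a₃0, a₃1, a₃2, a₃4}` restricted to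
the edges `9 ↦ a`, `10 ↦ b`, `11 ↦ c`, `12 ↦ d`, `13 ↦ e` (bit `idx2 ω` = the table at `ext5 ω a b c d e`), generated by
mining/mine-2/code/g28/lits5.c.  **`litOK_oa1a2b : LitOK 0 1 2 4 Loa1a2b`** (part 4) certifies all `608` literals against the
tables in the kernel (`lit_fffff`, …, `lit_ttttt`: one `decide +kernel` per restriction, the bit tree `bits9` evaluated on
the `512` nine-edge configurations of each; part 0 = the literals (statement-only), parts 1–4 = eight certifications each).  The `1024` slice certificates `CertS Loa1a2b j₁ … j₅` are
`PMK5Deg4CertsOA1A2B*.lean`.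
-/

namespace Summit.Ventures.PercRepro2

namespace Deg4

namespace Five

set_option maxHeartbeats 0 in
set_option maxRecDepth 100000 in
/-- The literals of the restriction `fffft` are the bit vectors of the restricted tables. -/
theorem lit_fffft : ∀ i : Fin 19, Loa1a2b i false false false false true = bits9 (res5 (tab 0 1 2 4 i) false false false false true) := by
  decide +kernel

set_option maxHeartbeats 0 in
set_option maxRecDepth 100000 in
/-- The literals of the restriction `tffft` are the bit vectors of the restricted tables. -/
theorem lit_tffft : ∀ i : Fin 19, Loa1a2b i true false false false true = bits9 (res5 (tab 0 1 2 4 i) true false false false true) := by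
  decide +kernel

set_option maxHeartbeats 0 in
set_option maxRecDepth 100000 in
/-- The literals of the restriction `ftfft` are the bit vectors of the restricted tables. -/
theorem lit_ftfft : ∀ i : Fin 19, Loa1a2b i false true false false true = bits9 (res5 (tab 0 1 2 4 i) false true false false true) := by
  decide +kernel

set_option maxHeartbeats 0 in
set_option maxRecDepth 100000 in
/-- The literals of the restriction `ttfft` are the bit vectors of the restricted tables. -/
theorem lit_ttfft : ∀ i : Fin 19, Loa1a2b i true true false false true = bits9 (res5 (tab 0 1 2 4 i) true true false false true) := by
  decide +kernel

set_option maxHeartbeats 0 in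
set_option maxRecDepth 100000 in
/-- The literals of the restriction `fftft` are the bit vectors of the restricted tables. -/
theorem lit_fftft : ∀ i : Fin 19, Loa1a2b i false false true false true = bits9 (res5 (tab 0 1 2 4 i) false false true false true) := by
  decide +kernel

set_option maxHeartbeats 0 in
set_option maxRecDepth 100000 in
/-- The literals of the restriction `tftft` are the bit vectors of the restricted tables. -/
theorem lit_tftft : ∀ i : Fin 19, Loa1a2b i true false true false true = bits9 (res5 (tab 0 1 2 4 i) true false true false true) := by
  decide +kernel

set_option maxHeartbeats 0 in
set_option maxRecDepth 100000 in
/-- The literals of the restriction `fttft` are the bit vectors of the restricted tables. -/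
theorem lit_fttft : ∀ i : Fin 19, Loa1a2b i false true true false true = bits9 (res5 (tab 0 1 2 4 i) false true true false true) := by
  decide +kernel

set_option maxHeartbeats 0 in
set_option maxRecDepth 100000 in
/-- The literals of the restriction `tttft` are the bit vectors of the restricted tables. -/
theorem lit_tttft : ∀ i : Fin 19, Loa1a2b i true true true false true = bits9 (res5 (tab 0 1 2 4 i) true true true false true) := by
  decide +kernel


end Five

end Deg4

end Summit.Ventures.PercRepro2
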